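import Summits.QuantumFields.BalabanUV.Beta.D1BFx.PackedAveragingTable
import Summits.QuantumFields.BalabanUV.Beta.D1BFx.CompositeLegMasses

/-!
# `BalabanUV.Beta.D1BFx.PackedAveragingWords` — road «BF-x» for binder row D1, slot (K), (J3)'s (C3) rows «THE FOUR `Q′`-WORDS, m-UNIFORM MASS»,
# FILE ε2 «(C3) WORDS»: **A BUBBLE IS THE TRACE OF THE LEG AGAINST A VERTEX SANDWICH, `|tr (A ∘ T)| ≤ sup|A|·TotMass T`, AND THE FOUR `Q′`-WORDS OF A
# BOUNDED, MASS-CONTROLLED LEG AT TWO LOCALISED WEIGHT FAMILIES ARE `≤ sup|A| × (envelope constants) × Zl × e^{−θ|P−P′|₁}`** — generic leg, generic weights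
# (the (C3) count of W-2 l.45546 at the letter level; the scales `n = L^k` and PART 16's spelling are FILE ε3)

HONEST DEPENDENCY (cell records, verbatim): «continuum YM on T⁴ ⇐ BetaPertH ∧ nine spine estimates (0/9 proved); BetaPertH ⇐ (D1) ∧ (D4) ∧
CAP+tail; G-an2-4 gates asym, D1 and NE2/3/4.»  HONEST FRAMING (cell contract, verbatim): «discharging `BetaPertH` makes Bałaban's UV stability
UNCONDITIONAL — a real constructive-QFT result; it is NOT the continuum limit and NOT the Clay problem.»  THIS MODULE DISCHARGES NOTHING of the
wall: [folklore] `ℓ¹` bookkeeping for the Literature's `ExpKernelCalculus.tr ∕ comp ∕ bubble ∕ tadpole` in this lineage's α1∕α2 currency — the sandwich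
`KernelMassTotal.totMass_sandwich`, the regrouping `TameKernelCalculus.comp_assoc_tame`, the local packed current's envelopes `CoframeVertices.cols_gW ∕ rows_gW` (δ2)
and FILE ε1∕ε1b's rank-two letters for the packed averaging current and its square table — BY NAME.  No definition, no `def … : Prop`, nothing cited, 0 sorry.  0 root-level binders of
row D1 discharged (hW ∕ hR-sockets ∕ hSX-socket ∕ D1Tel ∕ D1Rep = 0); (C3) NOT closed here (ε3 reads these letters on the scales); (K) NOT closed; NOT D1,
NOT `BetaPertH`, NOT continuum, NOT Clay.

ABSOLUTE RULE (cell charter, verbatim): «No internally-minted statement may enter as a cited fact. Every hypothesis is either kernel-proved in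
this package or a verbatim quotation of a PUBLISHED theorem with page reference. The manuscript(s) under audit are NOT citable for their own
disputed steps — they are the thing under adjudication; programme-internal (2001/route/tribunal) claims are never citable.»

WHY (W-2 l.45546; OWNER d1-p2 g20 PART 16 `hMRB hCB`).  The four `Q′`-words of `BR n` are `½·tadpole A 𝒲 − ½·(bubble A 𝒱_D 𝒱_Q + bubble A 𝒱_Q 𝒱_D +
bubble A 𝒱_Q 𝒱_Q)` with the leg `A = Ggh n a`, the LOCAL packed current `𝒱_D = n²•gW w` (a column meets 8 stencils: column sums `8·sup|w|`, δ2) and the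
RANK-TWO packed averaging current `𝒱_Q = a•qV ρ n w` (row sums `8n·sup|w|·e^{8nδ}`, ε1).  A bubble `tr ((A∘V)∘(A∘V′))` regroups (tame kernels) to
`tr (A ∘ ((V∘A)∘V′))`; the inner word is α2's VERTEX SANDWICH — total mass `ω·ω′·g·Zl 4 (κ−θ)·e^{−θ|c−c′|₁}` with `ω` the COLUMN envelope of `V`, `ω′` the ROW
envelope of `V′`, `g` the θ-weighted row mass of the middle leg — and the outer leg is read by its sup: `|tr (A∘T)| ≤ sup|A|·TotMass T` (no cyclicity, no
lattice constant).  At the road's letters (`sup|Ggh| ≍ n⁻²`, `g ≍ n⁰` on `n = L^k`, `sup|colH G₀| ≍ n⁻⁴`, `Zl ≍ n⁴`): cross words `≍ n⁻²·n⁻²·n⁻³·n⁴ = n⁻³`,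
QQ word `≍ n⁻⁴`, tadpole `≍ n⁻²·n⁻²= n⁻⁴` — the (C3) rows with room (ε3).

CONTENT (all [folklore]; `MKer 4 Unit`; `θ ≥ 0`).
* §1 **`abs_tr_comp_le`**: `(∀ x y, |A x y| ≤ β)`, `TotMass T M` ⟹ `|tr (A ∘ T)| ≤ β·M`; `rows_smul` ∕ `cols_smul` (localised row∕column envelopes scale by `|c|`),
  `tame_smul_of_masses`.
* §2 **`bubble_eq_tr_sandwich`** (masses at `0` for `A V V′` ⟹ `bubble A V V′ = tr (A ∘ ((V ∘ A) ∘ V′))`), **`abs_bubble_le_sandwich`** (the generic bubble bound: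
  `|bubble A V V′| ≤ β·(ω·ω′·g·Zl 4 (κ−θ)·e^{−θ|c−c′|₁})`), `abs_tadpole_le_totMass`.
* §3 the four `Q′`-words at two weight families `w`, `w′` (envelopes `C·e^{−δ|u−P|₁}`, `C′·e^{−δ|u−P′|₁}`, `0 ≤ θ < δ`): **`abs_bubble_DQ_le`**, **`abs_bubble_QD_le`**,
  **`abs_bubble_QQ_le`**, **`abs_tadpole_QQ_le`** — each `≤ β × (explicit product of ε1∕δ2 envelope constants) × g × Zl 4 (δ−θ) × e^{−θ|P−P′|₁}` (tadpole without `g`).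
NOT HERE: `A = Ggh (L^k) a`, `w = colH G₀`, PART 16's spelling (ε3).
Unit `b2b-balaban-gan24-formalise-leaf-05` (gen 55), G-an2-4 swarm leaf prover 05, road «BF-x» supplier; INTENT «(C3) DIRECT» ε2 (journal).
-/

noncomputable section

namespace Summit.QuantumFields.BalabanUV.Beta.D1BFx.PackedAveragingWords

open Finset
open scoped BigOperators
open Literature.MathematicalPhysics.QuantumFieldTheory.Balaban1983to89
open Literature.MathematicalPhysics.QuantumFieldTheory.Balaban1983to89.Beta
open B12Sec2to5 (l1 l1_nonneg)
open ExpKernelCalculus (Site MKer comp tr bubble tadpole Zl Zl_pos l1_sub_symm)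
open OneStepResolventKernel (wsum)
open Summit.QuantumFields.BalabanUV.Beta.TameKernelCalculus (Tame trK comp_assoc_tame)
open Summit.QuantumFields.BalabanUV.Beta.D1BFx.PackedCoframeSiteWords (gW)
open Summit.QuantumFields.BalabanUV.Beta.D1BFx.GhostLegMasses (rowFn_unit)
open Summit.QuantumFields.BalabanUV.Beta.D1BFx.CoframeVertices (const_nonneg cols_gW rows_gW masses_gW)
open Summit.QuantumFields.BalabanUV.Beta.D1BFx.CompositeLegMasses (tame_of_masses)
open Summit.QuantumFields.BalabanUV.Beta.D1BFx.KernelMassCalculus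
open Summit.QuantumFields.BalabanUV.Beta.D1BFx.KernelMassTotal
open Summit.QuantumFields.BalabanUV.Beta.D1BFx.PackedAveragingVertex
open Summit.QuantumFields.BalabanUV.Beta.D1BFx.PackedAveragingTable

/-! ## §1 The trace of a bounded leg against a kernel of finite total mass; scaled envelopes -/

section Trace

variable {A T K : MKer 4 Unit} {β M : ℝ}

/-- [folklore] **THE OUTER LEG BY ITS SUP**: `|A x y| ≤ β` everywhere and `TotMass T M` ⟹ `|tr (A ∘ T)| ≤ β·M`
(`tr (A∘T) = Σ'_x Σ'_y A(x,y)·T(y,x)`, and the double series of `|T(y,x)|` is the total mass read column-first, `totMass_trK`). -/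
theorem abs_tr_comp_le (hA : ∀ x y : Site 4, |A x y () ()| ≤ β) (hT : TotMass T M) : |tr (comp A T)| ≤ β * M := by
  have hβ : 0 ≤ β := (abs_nonneg _).trans (hA 0 0)
  obtain ⟨h1, h2, hle⟩ := totMass_iff.1 (totMass_trK hT)
  -- the inner series at the site `x`
  have hin : ∀ x : Site 4, |comp A T x x () ()| ≤ β * ∑' y, rowFn (trK T) 0 x y := by
    intro x
    have hs : HasSum (fun y => β * rowFn (trK T) 0 x y) (β * ∑' y, rowFn (trK T) 0 x y) := ((h1 x).hasSum).mul_left β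
    have hb := tsum_of_norm_bounded hs (f := fun y : Site 4 => ∑ f : Unit, A x y () f * T y x f ()) (fun y => by
      rw [Real.norm_eq_abs, Fintype.sum_unique, rowFn_unit, zero_mul, Real.exp_zero, mul_one, abs_mul]
      show |A x y () ()| * |T y x () ()| ≤ β * |trK T x y () ()|
      exact mul_le_mul_of_nonneg_right (hA x y) (abs_nonneg _))
    rw [Real.norm_eq_abs] at hb
    exact hb
  have hs2 : HasSum (fun x => β * ∑' y, rowFn (trK T) 0 x y) (β * ∑' x, ∑' y, rowFn (trK T) 0 x y) := (h2.hasSum).mul_left β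
  have hb2 := tsum_of_norm_bounded hs2 (f := fun x : Site 4 => ∑ a : Unit, comp A T x x a a) (fun x => by
    rw [Real.norm_eq_abs, Fintype.sum_unique]; exact hin x)
  rw [Real.norm_eq_abs] at hb2
  unfold tr
  exact hb2.trans (mul_le_mul_of_nonneg_left hle hβ)

/-- [folklore] **THE TADPOLE BY SUP × TOTAL MASS**: `|tadpole A W| ≤ β·M`. -/
theorem abs_tadpole_le_totMass {W : MKer 4 Unit} (hA : ∀ x y : Site 4, |A x y () ()| ≤ β) (hW : TotMass W M) : |tadpole A W| ≤ β * M :=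
  abs_tr_comp_le hA hW

/-- [folklore] Scaling a kernel scales its row profile: `rowFn (c•K) θ x y = |c|·rowFn K θ x y`. -/
theorem rowFn_const_smul (c θ : ℝ) (x y : Site 4) : rowFn (c • K) θ x y = |c| * rowFn K θ x y := by
  rw [rowFn_unit, rowFn_unit, Pi.smul_apply, Pi.smul_apply, Pi.smul_apply, Pi.smul_apply, smul_eq_mul, abs_mul, mul_assoc]

/-- [folklore] **SCALED ROW ENVELOPE**: localised row sums `≤ E x` for `K` ⟹ `≤ |c|·E x` for `c•K`. -/
theorem rows_smul {E : Site 4 → ℝ} (c : ℝ) (h : ∀ x, Summable (rowFn K 0 x) ∧ ∑' y, rowFn K 0 x y ≤ E x) (x : Site 4) :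
    Summable (rowFn (c • K) 0 x) ∧ ∑' y, rowFn (c • K) 0 x y ≤ |c| * E x := by
  have e : rowFn (c • K) 0 x = fun y => |c| * rowFn K 0 x y := funext fun y => rowFn_const_smul c 0 x y
  rw [e]
  refine ⟨(h x).1.mul_left _, ?_⟩
  rw [tsum_mul_left]
  exact mul_le_mul_of_nonneg_left (h x).2 (abs_nonneg c)

/-- [folklore] **SCALED COLUMN ENVELOPE**: localised column sums `≤ E y` for `K` ⟹ `≤ |c|·E y` for `c•K`. -/
theorem cols_smul {E : Site 4 → ℝ} (c : ℝ) (h : ∀ y, (Summable fun x => rowFn K 0 x y) ∧ ∑' x, rowFn K 0 x y ≤ E y) (y : Site 4) :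
    (Summable fun x => rowFn (c • K) 0 x y) ∧ ∑' x, rowFn (c • K) 0 x y ≤ |c| * E y := by
  have e : (fun x => rowFn (c • K) 0 x y) = fun x => |c| * rowFn K 0 x y := funext fun x => rowFn_const_smul c 0 x y
  rw [e]
  refine ⟨(h y).1.mul_left _, ?_⟩
  rw [tsum_mul_left]
  exact mul_le_mul_of_nonneg_left (h y).2 (abs_nonneg c)

end Trace

/-! ## §2 The bubble as the trace of the leg against a vertex sandwich -/

section Bubble

variable {A V V' : MKer 4 Unit} {θ g β ρV γV ρV' γV' ω ω' κ : ℝ} {c c' : Site 4}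

/-- [folklore] **THE BUBBLE REGROUPED**: for kernels with finite row and column masses, `bubble A V V′ = tr (A ∘ ((V ∘ A) ∘ V′))`
(`TameKernelCalculus.comp_assoc_tame` twice; tameness from the masses, γ3 `tame_of_masses`). -/
theorem bubble_eq_tr_sandwich {rA cA : ℝ} (hArow : RowMass A 0 rA) (hAcol : ColMass A 0 cA)
    (hVrow : RowMass V 0 ρV) (hVcol : ColMass V 0 γV) (hV'row : RowMass V' 0 ρV') (hV'col : ColMass V' 0 γV') :
    bubble A V V' = tr (comp A (comp (comp V A) V')) := by
  have hA : Tame A := tame_of_masses hArow hAcol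
  have hV : Tame V := tame_of_masses hVrow hVcol
  have hV' : Tame V' := tame_of_masses hV'row hV'col
  have hAV' : Tame (comp A V') := tame_of_masses (rowMass_comp hArow hV'row le_rfl) (colMass_comp hAcol hV'col le_rfl)
  unfold bubble
  rw [← comp_assoc_tame hA hV hAV', comp_assoc_tame hV hA hV']

/-- [folklore] **THE GENERIC BUBBLE BOUND OF THE (C3) COUNT**: a leg `A` with `|A| ≤ β` and θ-weighted row∕column mass `g` (`0 ≤ θ < κ`), a vertex `V` with
COLUMN sums `≤ ω·e^{−κ|u′−c|₁}` and a vertex `V′` with ROW sums `≤ ω′·e^{−κ|v−c′|₁}` (plus plain masses for convergence) ⟹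
`|bubble A V V′| ≤ β·(ω·ω′·g·Zl 4 (κ−θ)·e^{−θ|c−c′|₁})` — α2's sandwich inside, the outer leg by its sup. -/
theorem abs_bubble_le_sandwich (hAβ : ∀ x y : Site 4, |A x y () ()| ≤ β) (hA : RowMass A θ g ∧ ColMass A θ g) (hθ : 0 ≤ θ) (hθκ : θ < κ)
    (hVrow : RowMass V 0 ρV) (hVcol : ColMass V 0 γV)
    (hVcols : ∀ u', (Summable fun u => rowFn V 0 u u') ∧ ∑' u, rowFn V 0 u u' ≤ ω * Real.exp (-κ * l1 (u' - c)))
    (hV'row : RowMass V' 0 ρV') (hV'col : ColMass V' 0 γV')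
    (hV'rows : ∀ v, Summable (rowFn V' 0 v) ∧ ∑' v', rowFn V' 0 v v' ≤ ω' * Real.exp (-κ * l1 (v - c'))) :
    |bubble A V V'| ≤ β * (ω * ω' * g * Zl 4 (κ - θ) * Real.exp (-θ * l1 (c - c'))) := by
  rw [bubble_eq_tr_sandwich (hA.1.mono hθ le_rfl) (hA.2.mono hθ le_rfl) hVrow hVcol hV'row hV'col]
  exact abs_tr_comp_le hAβ (totMass_sandwich hVrow hVcols hA.1 hθ hθκ hV'col hV'rows)

end Bubble

/-! ## §3 The four `Q′`-words at two localised weight families -/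

section Words

variable (ρ : Site 4) (n : ℕ) [NeZero n] {A : MKer 4 Unit} {w w' : Fin 4 → Site 4 → ℝ} {θ g β C C' δ : ℝ} {P P' : Site 4}

/-- [folklore] **CROSS WORD `D`–`Q′`**: `|bubble A (cD•gW w) (cQ•qV ρ n w′)| ≤ β·((|cD|·(8·C·e^{δ}))·(|cQ|·(8n·C′·e^{8nδ}))·g·Zl 4 (δ−θ)·e^{−θ|P−P′|₁})`
— the local current by its COLUMN envelope (δ2 `cols_gW`), the averaging current by its ROW envelope (ε1 `rows_qV`). -/
theorem abs_bubble_DQ_le (hAβ : ∀ x y : Site 4, |A x y () ()| ≤ β) (hA : RowMass A θ g ∧ ColMass A θ g) (hθ : 0 ≤ θ) (hθδ : θ < δ)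
    (hw : ∀ κ u, |w κ u| ≤ C * Real.exp (-δ * l1 (u - P))) (hw' : ∀ κ u, |w' κ u| ≤ C' * Real.exp (-δ * l1 (u - P'))) (cD cQ : ℝ) :
    |bubble A (cD • gW w) (cQ • qV ρ n w')|
      ≤ β * ((|cD| * (8 * C * Real.exp δ)) * (|cQ| * (8 * n * C' * Real.exp (8 * n * δ))) * g * Zl 4 (δ - θ) * Real.exp (-θ * l1 (P - P'))) := by
  have hδ : 0 ≤ δ := hθ.trans hθδ.le
  obtain ⟨hVr, hVc⟩ := masses_gW hw hδ
  obtain ⟨hV'r, hV'c⟩ := masses_qV ρ n hw' hδ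
  have hcols : ∀ u', (Summable fun u => rowFn (cD • gW w) 0 u u') ∧
      ∑' u, rowFn (cD • gW w) 0 u u' ≤ |cD| * (8 * C * Real.exp δ) * Real.exp (-δ * l1 (u' - P)) := fun u' => by
    have h := cols_smul cD (fun y => cols_gW hw hδ y) u'
    exact ⟨h.1, h.2.trans (le_of_eq (by ring))⟩
  have hrows : ∀ v, Summable (rowFn (cQ • qV ρ n w') 0 v) ∧
      ∑' v', rowFn (cQ • qV ρ n w') 0 v v' ≤ |cQ| * (8 * n * C' * Real.exp (8 * n * δ)) * Real.exp (-δ * l1 (v - P')) := fun v => by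
    have h := rows_smul cQ (fun x => rows_qV ρ n hw' hδ x) v
    exact ⟨h.1, h.2.trans (le_of_eq (by ring))⟩
  exact abs_bubble_le_sandwich hAβ hA hθ hθδ (hVr.smul cD) (hVc.smul cD) hcols (hV'r.smul cQ) (hV'c.smul cQ) hrows

/-- [folklore] **CROSS WORD `Q′`–`D`**: `|bubble A (cQ•qV ρ n w) (cD•gW w′)| ≤ β·((|cQ|·(8n·C·e^{8nδ}))·(|cD|·(8·C′·e^{δ}))·g·Zl 4 (δ−θ)·e^{−θ|P−P′|₁})`
(ε1 `cols_qV`, δ2 `rows_gW`). -/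
theorem abs_bubble_QD_le (hAβ : ∀ x y : Site 4, |A x y () ()| ≤ β) (hA : RowMass A θ g ∧ ColMass A θ g) (hθ : 0 ≤ θ) (hθδ : θ < δ)
    (hw : ∀ κ u, |w κ u| ≤ C * Real.exp (-δ * l1 (u - P))) (hw' : ∀ κ u, |w' κ u| ≤ C' * Real.exp (-δ * l1 (u - P'))) (cQ cD : ℝ) :
    |bubble A (cQ • qV ρ n w) (cD • gW w')|
      ≤ β * ((|cQ| * (8 * n * C * Real.exp (8 * n * δ))) * (|cD| * (8 * C' * Real.exp δ)) * g * Zl 4 (δ - θ) * Real.exp (-θ * l1 (P - P'))) := by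
  have hδ : 0 ≤ δ := hθ.trans hθδ.le
  obtain ⟨hVr, hVc⟩ := masses_qV ρ n hw hδ
  obtain ⟨hV'r, hV'c⟩ := masses_gW hw' hδ
  have hcols : ∀ u', (Summable fun u => rowFn (cQ • qV ρ n w) 0 u u') ∧
      ∑' u, rowFn (cQ • qV ρ n w) 0 u u' ≤ |cQ| * (8 * n * C * Real.exp (8 * n * δ)) * Real.exp (-δ * l1 (u' - P)) := fun u' => by
    have h := cols_smul cQ (fun y => cols_qV ρ n hw hδ y) u'
    exact ⟨h.1, h.2.trans (le_of_eq (by ring))⟩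
  have hrows : ∀ v, Summable (rowFn (cD • gW w') 0 v) ∧
      ∑' v', rowFn (cD • gW w') 0 v v' ≤ |cD| * (8 * C' * Real.exp δ) * Real.exp (-δ * l1 (v - P')) := fun v => by
    have h := rows_smul cD (fun x => rows_gW hw' hδ x) v
    exact ⟨h.1, h.2.trans (le_of_eq (by ring))⟩
  exact abs_bubble_le_sandwich hAβ hA hθ hθδ (hVr.smul cQ) (hVc.smul cQ) hcols (hV'r.smul cD) (hV'c.smul cD) hrows

/-- [folklore] **PURE WORD `Q′`–`Q′`**: `|bubble A (cQ•qV ρ n w) (cQ′•qV ρ n w′)| ≤ β·((|cQ|·(8n·C·e^{8nδ}))·(|cQ′|·(8n·C′·e^{8nδ}))·g·Zl 4 (δ−θ)·e^{−θ|P−P′|₁})`. -/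
theorem abs_bubble_QQ_le (hAβ : ∀ x y : Site 4, |A x y () ()| ≤ β) (hA : RowMass A θ g ∧ ColMass A θ g) (hθ : 0 ≤ θ) (hθδ : θ < δ)
    (hw : ∀ κ u, |w κ u| ≤ C * Real.exp (-δ * l1 (u - P))) (hw' : ∀ κ u, |w' κ u| ≤ C' * Real.exp (-δ * l1 (u - P'))) (cQ cQ' : ℝ) :
    |bubble A (cQ • qV ρ n w) (cQ' • qV ρ n w')|
      ≤ β * ((|cQ| * (8 * n * C * Real.exp (8 * n * δ))) * (|cQ'| * (8 * n * C' * Real.exp (8 * n * δ))) * g * Zl 4 (δ - θ)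
          * Real.exp (-θ * l1 (P - P'))) := by
  have hδ : 0 ≤ δ := hθ.trans hθδ.le
  obtain ⟨hVr, hVc⟩ := masses_qV ρ n hw hδ
  obtain ⟨hV'r, hV'c⟩ := masses_qV ρ n hw' hδ
  have hcols : ∀ u', (Summable fun u => rowFn (cQ • qV ρ n w) 0 u u') ∧
      ∑' u, rowFn (cQ • qV ρ n w) 0 u u' ≤ |cQ| * (8 * n * C * Real.exp (8 * n * δ)) * Real.exp (-δ * l1 (u' - P)) := fun u' => by
    have h := cols_smul cQ (fun y => cols_qV ρ n hw hδ y) u'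
    exact ⟨h.1, h.2.trans (le_of_eq (by ring))⟩
  have hrows : ∀ v, Summable (rowFn (cQ' • qV ρ n w') 0 v) ∧
      ∑' v', rowFn (cQ' • qV ρ n w') 0 v v' ≤ |cQ'| * (8 * n * C' * Real.exp (8 * n * δ)) * Real.exp (-δ * l1 (v - P')) := fun v => by
    have h := rows_smul cQ' (fun x => rows_qV ρ n hw' hδ x) v
    exact ⟨h.1, h.2.trans (le_of_eq (by ring))⟩
  exact abs_bubble_le_sandwich hAβ hA hθ hθδ (hVr.smul cQ) (hVc.smul cQ) hcols (hV'r.smul cQ') (hV'c.smul cQ') hrows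

omit [NeZero n] in
/-- [folklore] **THE TADPOLE OF THE PACKED `Q′*Q′` TABLE**: `|tadpole A (x z ↦ cW·(qV w x z·qV w′ x z))| ≤
β·(|cW|·(8n·(n⁴)⁻¹·C·e^{8nδ})·(8n·C′·e^{8nδ})·Zl 4 (δ−θ)·e^{−θ|P−P′|₁})` (ε1b `totMass_qTable`, the leg by its sup; no leg mass). -/
theorem abs_tadpole_QQ_le [NeZero n] (hAβ : ∀ x y : Site 4, |A x y () ()| ≤ β) (hθ : 0 ≤ θ) (hθδ : θ < δ)
    (hw : ∀ κ u, |w κ u| ≤ C * Real.exp (-δ * l1 (u - P))) (hw' : ∀ κ u, |w' κ u| ≤ C' * Real.exp (-δ * l1 (u - P'))) (cW : ℝ) :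
    |tadpole A (fun x z a b => cW * (qV ρ n w x z a b * qV ρ n w' x z a b))|
      ≤ β * (|cW| * (8 * n * ((n : ℝ) ^ 4)⁻¹ * C * Real.exp (8 * n * δ)) * (8 * n * C' * Real.exp (8 * n * δ)) * Zl 4 (δ - θ)
          * Real.exp (-θ * l1 (P - P'))) :=
  abs_tadpole_le_totMass hAβ (totMass_qTable ρ n hw hw' hθ hθδ cW)

end Words

end Summit.QuantumFields.BalabanUV.Beta.D1BFx.PackedAveragingWords

end
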